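import Summits.HubbardSuperconductivity.HubbardSuperconductivity.Theorems.TwSourcedCondensation.Negative.FiniteVolumeResponseBounds

/-!
# Crux `TwSourcedCondensation` (item `stmt-HubbardSuperconductivity-1697`): five natural
strengthenings REFUTED — which parts of the statement are load-bearing

The crux (`Theses.ThermalWedge.TwSourcedCondensation`) is
`∀[μ₁,μ₂]⊂(-4,0) ∃U₀ a c C h₀>0 ∀U∈(0,U₀] ∀β∈[1,e^{a/U}] ∀μ∈[μ₁,μ₂] ∃L₀ ∀L≥L₀ ∀|h|≤h₀:
c h² log(1/(|h|+1/β)) - C h² ≤ p̃_L(h) - p̃_L(0)`, with the sourced torus pressure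
`p̃_L(h) = log Re Z_β(dWaveSourceTorus L U μ h)/(βL²)` (spelled out below; no definition is introduced).
Each theorem here is `¬ S` for a strengthening `S` obtained by mutating ONE ingredient; the witnesses
use only the a priori structure of the response proved in `SourceResponseStructure` and
`FiniteVolumeResponseBounds` (`RHS ≥ 0`, even, `≤ 8√2|h|`, `≤ 256βL²h²`, `≡ 0` at `L = 1`):

* `twSourcedCondensation_false_allL` — "eventually in `L`" replaced by "for every `L ≥ 1`": FALSE
  (the `1 × 1` torus has `Δ_d = 0`; witness `h = 1/β = e^{-a/U}`). `L₀ ≥ 2` is load-bearing.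
* `twSourcedCondensation_false_fromBetaZero` — `1 ≤ β` weakened to `0 ≤ β`: FALSE through junk
  arithmetic only (`1/0 = 0`, `log Z/(0·L²) = 0`); certifies that a temperature floor must stay.
* `twSourcedCondensation_false_logBeta` — `log(1/(|h|+1/β))` strengthened to `log β`: FALSE (the
  response is `≤ 8√2|h|`, the floor at `h = h₀` would be `c h₀² a/U`). The SOURCE cuts the log off.
* `twSourcedCondensation_false_noCutoff` — `log(1/(|h|+1/β))` strengthened to `log(1/|h|)`: FALSE
  (fixed-volume response `≤ 256βL²h²`, the floor diverges logarithmically as `h → 0`). The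
  TEMPERATURE cuts the log off too: finite-volume susceptibilities are finite.
* `twSourcedCondensation_false_linearResponse` — order `h²` strengthened to `|h|` (a first-order,
  symmetry-breaking-like response `c|h| ≤ RHS`): FALSE at every finite `L` (quadratic bound).

So the crux's left-hand side `h²·log(1/(|h|+1/β))` is the strongest member of its natural family not
already dead at finite volume. (The complementary DECORATIVE hypotheses — `U ≤ U₀`, `|h| ≤ h₀`, the
sign of `h` — and the frozen-threshold obstruction are in the disprover's workfile
`Cruxes/TwSourcedCondensation/Disproof.lean`, §4e and §7a.)
-/

noncomputable section

namespace Summit.HubbardSuperconductivity.HubbardSuperconductivity.Theorems.TwSourcedCondensation.Negative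

open Matrix Finset Literature.MathematicalPhysics.QuantumLattice Literature.Probability.LatticeModels
open Summit.HubbardSuperconductivity.HubbardSuperconductivity.Theorems
open scoped Matrix.Norms.L2Operator ComplexOrder

/-! ### Two real-variable helpers -/

/-- A large ratio `a/U` inside `(0, U₀]`: for `M > 0` some `0 < U ≤ U₀` has `a/U ≥ M`. [folklore] -/
theorem exists_small_coupling {U₀ a : ℝ} (hU₀ : 0 < U₀) (ha : 0 < a) {M : ℝ} (hM : 0 < M) :
    ∃ U : ℝ, 0 < U ∧ U ≤ U₀ ∧ M ≤ a / U := by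
  refine ⟨min U₀ (a / M), lt_min hU₀ (div_pos ha hM), min_le_left _ _, ?_⟩
  rw [le_div_iff₀ (lt_min hU₀ (div_pos ha hM))]
  calc M * min U₀ (a / M) ≤ M * (a / M) := mul_le_mul_of_nonneg_left (min_le_right _ _) hM.le
    _ = a := mul_div_cancel₀ a hM.ne'

/-- The `1 × 1` response vanishes: `p̃_1(h) - p̃_1(0) = 0`. [folklore] -/
theorem pressure_response_one (β U μ h : ℝ) :
    Real.log (partitionFn β (dWaveSourceTorus 1 U μ h)).re / (β * ((1 : ℕ) : ℝ) ^ 2) -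
      Real.log (partitionFn β (dWaveSourceTorus 1 U μ 0)).re / (β * ((1 : ℕ) : ℝ) ^ 2) = 0 := by
  rw [dWaveSourceTorus_one U μ h, sub_self]

/-! ### 1. `∃ L₀` is load-bearing -/

/-- **FALSE with "for every `L ≥ 1`" in place of "eventually in `L`"**: on the `1 × 1` torus the
response is `0`, while at `h = 1/β = e^{-a/U}` the claimed floor is `e^{-2a/U}(c(a/U - log 2) - C) > 0`
once `a/U > log 2 + C/c` — and `a/U` is at the refuter's disposal inside `(0, U₀]`. [folklore] -/
theorem twSourcedCondensation_false_allL :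
    ¬ (∀ μ₁ μ₂ : ℝ, -4 < μ₁ → μ₁ ≤ μ₂ → μ₂ < 0 → ∃ U₀ a c C h₀ : ℝ, 0 < U₀ ∧ 0 < a ∧ 0 < c ∧ 0 < C ∧
      0 < h₀ ∧ ∀ U : ℝ, 0 < U → U ≤ U₀ → ∀ β : ℝ, 1 ≤ β → β ≤ Real.exp (a / U) →
      ∀ μ ∈ Set.Icc μ₁ μ₂, ∀ (L : ℕ) [NeZero L], ∀ h : ℝ, |h| ≤ h₀ →
        c * h ^ 2 * Real.log (1 / (|h| + 1 / β)) - C * h ^ 2 ≤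
          Real.log (partitionFn β (dWaveSourceTorus L U μ h)).re / (β * (L : ℝ) ^ 2) -
            Real.log (partitionFn β (dWaveSourceTorus L U μ 0)).re / (β * (L : ℝ) ^ 2)) := by
  intro H
  obtain ⟨U₀, a, c, C, h₀, hU₀, ha, hc, hC, hh₀, H⟩ := H (-2) (-2) (by norm_num) le_rfl (by norm_num)
  have hMpos : 0 < |Real.log 2 + C / c| + |Real.log h₀| + 1 := by positivity
  obtain ⟨U, hUpos, hUle, haU⟩ := exists_small_coupling hU₀ ha hMpos
  set β : ℝ := Real.exp (a / U) with hβ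
  have hβpos : 0 < β := Real.exp_pos _
  have hβ1 : 1 ≤ β := Real.one_le_exp (div_nonneg ha.le hUpos.le)
  have hhβ : |1 / β| ≤ h₀ := by
    rw [abs_of_pos (one_div_pos.2 hβpos), hβ, one_div, ← Real.exp_neg, ← Real.le_log_iff_exp_le hh₀]
    linarith [neg_abs_le (Real.log h₀), abs_nonneg (Real.log 2 + C / c)]
  have key := H U hUpos hUle β hβ1 le_rfl (-2) ⟨le_rfl, le_rfl⟩ 1 (1 / β) hhβ
  rw [pressure_response_one] at key
  have hlog : Real.log (1 / (|1 / β| + 1 / β)) = a / U - Real.log 2 := by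
    rw [abs_of_pos (one_div_pos.2 hβpos), show 1 / (1 / β + 1 / β) = β / 2 by field_simp; ring,
      Real.log_div hβpos.ne' two_ne_zero, hβ, Real.log_exp]
  rw [hlog] at key
  have h1 : Real.log 2 + C / c < a / U := by
    linarith [le_abs_self (Real.log 2 + C / c), abs_nonneg (Real.log h₀)]
  have h2 : 0 < c * (a / U - Real.log 2) - C := by
    have : C / c < a / U - Real.log 2 := by linarith
    rw [div_lt_iff₀ hc] at this
    linarith
  have h3 : 0 < (1 / β) ^ 2 := by positivity
  have h4 : (1 / β) ^ 2 * (c * (a / U - Real.log 2) - C) =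
      c * (1 / β) ^ 2 * (a / U - Real.log 2) - C * (1 / β) ^ 2 := by ring
  linarith [mul_pos h3 h2]

/-! ### 2. `1 ≤ β` (a temperature floor) is load-bearing, but only through junk at `β = 0` -/

/-- **FALSE from `β = 0`**: `1/0 = 0` deletes the cutoff inside the logarithm while
`log Z/(0·L²) = 0`; at `0 < |h| < e^{-C/c - 1}` the floor is positive, the response `0`. Physics-free;
it only certifies that the hypothesis `1 ≤ β` (or any `β₀ > 0`) cannot be dropped. [folklore] -/
theorem twSourcedCondensation_false_fromBetaZero :
    ¬ (∀ μ₁ μ₂ : ℝ, -4 < μ₁ → μ₁ ≤ μ₂ → μ₂ < 0 → ∃ U₀ a c C h₀ : ℝ, 0 < U₀ ∧ 0 < a ∧ 0 < c ∧ 0 < C ∧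
      0 < h₀ ∧ ∀ U : ℝ, 0 < U → U ≤ U₀ → ∀ β : ℝ, 0 ≤ β → β ≤ Real.exp (a / U) →
      ∀ μ ∈ Set.Icc μ₁ μ₂, ∃ L₀ : ℕ, ∀ (L : ℕ) [NeZero L], L₀ ≤ L → ∀ h : ℝ, |h| ≤ h₀ →
        c * h ^ 2 * Real.log (1 / (|h| + 1 / β)) - C * h ^ 2 ≤
          Real.log (partitionFn β (dWaveSourceTorus L U μ h)).re / (β * (L : ℝ) ^ 2) -
            Real.log (partitionFn β (dWaveSourceTorus L U μ 0)).re / (β * (L : ℝ) ^ 2)) := by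
  intro H
  obtain ⟨U₀, a, c, C, h₀, hU₀, ha, hc, hC, hh₀, H⟩ := H (-2) (-2) (by norm_num) le_rfl (by norm_num)
  obtain ⟨L₀, hL₀⟩ := H U₀ hU₀ le_rfl 0 le_rfl (Real.exp_pos _).le (-2) ⟨le_rfl, le_rfl⟩
  set h : ℝ := min h₀ (Real.exp (-(C / c + 1))) with hh
  have hhpos : 0 < h := lt_min hh₀ (Real.exp_pos _)
  have key := hL₀ (L₀ + 1) (Nat.le_succ _) h (by rw [abs_of_pos hhpos]; exact min_le_left _ _)
  have hR : Real.log (partitionFn 0 (dWaveSourceTorus (L₀ + 1) U₀ (-2) h)).re / (0 * ((L₀ + 1 : ℕ) : ℝ) ^ 2) -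
      Real.log (partitionFn 0 (dWaveSourceTorus (L₀ + 1) U₀ (-2) 0)).re / (0 * ((L₀ + 1 : ℕ) : ℝ) ^ 2) = 0 := by
    simp
  rw [hR, abs_of_pos hhpos, div_zero, add_zero, one_div, Real.log_inv] at key
  have hlogh : Real.log h ≤ -(C / c + 1) := by
    rw [Real.log_le_iff_le_exp hhpos]; exact min_le_right _ _
  have h2 : 0 < c * -Real.log h - C := by
    have : C / c + 1 ≤ -Real.log h := by linarith
    have hcc : C / c * c = C := div_mul_cancel₀ C hc.ne'
    nlinarith
  have h3 : 0 < h ^ 2 := by positivity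
  have h4 : h ^ 2 * (c * -Real.log h - C) = c * h ^ 2 * -Real.log h - C * h ^ 2 := by ring
  linarith [mul_pos h3 h2]

/-! ### 3. The source inside the logarithm is load-bearing: the `log β` version is false -/

/-- **FALSE with `log β` in place of `log(1/(|h|+1/β))`**: at `h = h₀`, `β = e^{a/U}` the floor is
`h₀²(c·a/U - C)`, unbounded as `U → 0`, while the response is `≤ 8√2 h₀` uniformly
(`sourcedGain_le_linear`). [folklore] -/
theorem twSourcedCondensation_false_logBeta :
    ¬ (∀ μ₁ μ₂ : ℝ, -4 < μ₁ → μ₁ ≤ μ₂ → μ₂ < 0 → ∃ U₀ a c C h₀ : ℝ, 0 < U₀ ∧ 0 < a ∧ 0 < c ∧ 0 < C ∧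
      0 < h₀ ∧ ∀ U : ℝ, 0 < U → U ≤ U₀ → ∀ β : ℝ, 1 ≤ β → β ≤ Real.exp (a / U) →
      ∀ μ ∈ Set.Icc μ₁ μ₂, ∃ L₀ : ℕ, ∀ (L : ℕ) [NeZero L], L₀ ≤ L → ∀ h : ℝ, |h| ≤ h₀ →
        c * h ^ 2 * Real.log β - C * h ^ 2 ≤
          Real.log (partitionFn β (dWaveSourceTorus L U μ h)).re / (β * (L : ℝ) ^ 2) -
            Real.log (partitionFn β (dWaveSourceTorus L U μ 0)).re / (β * (L : ℝ) ^ 2)) := by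
  intro H
  obtain ⟨U₀, a, c, C, h₀, hU₀, ha, hc, hC, hh₀, H⟩ := H (-2) (-2) (by norm_num) le_rfl (by norm_num)
  have hMpos : 0 < (2 * (8 * Real.sqrt 2) / h₀ + C) / c + 1 := by positivity
  obtain ⟨U, hUpos, hUle, haU⟩ := exists_small_coupling hU₀ ha hMpos
  set β : ℝ := Real.exp (a / U) with hβ
  have hβpos : 0 < β := Real.exp_pos _
  have hβ1 : 1 ≤ β := Real.one_le_exp (div_nonneg ha.le hUpos.le)
  obtain ⟨L₀, hL₀⟩ := H U hUpos hUle β hβ1 le_rfl (-2) ⟨le_rfl, le_rfl⟩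
  have key := hL₀ (L₀ + 1) (Nat.le_succ _) h₀ (by rw [abs_of_pos hh₀])
  have hlip := sourcedGain_le_linear (L₀ + 1) U (-2) hβpos h₀
  rw [abs_of_pos hh₀] at hlip
  rw [hβ, Real.log_exp] at key
  have h1 : 2 * (8 * Real.sqrt 2) / h₀ + C + c ≤ c * (a / U) := by
    have := mul_le_mul_of_nonneg_left haU hc.le
    rw [mul_add, mul_one, mul_div_cancel₀ _ hc.ne'] at this
    exact this
  have h2 : h₀ ^ 2 * (2 * (8 * Real.sqrt 2) / h₀ + C + c) =
      2 * (8 * Real.sqrt 2) * h₀ + C * h₀ ^ 2 + c * h₀ ^ 2 := by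
    field_simp
  have h3 : 0 < c * h₀ ^ 2 := by positivity
  have h4 : 0 ≤ 8 * Real.sqrt 2 * h₀ := by positivity
  nlinarith [mul_le_mul_of_nonneg_left h1 (sq_nonneg h₀)]

/-! ### 4. The temperature inside the logarithm is load-bearing: the `log(1/|h|)` version is false -/

/-- **FALSE with the bare `log(1/|h|)`**: at fixed `(U, β = 1, L)` the response is `≤ B h²`,
`B = 256βL²` (`pressure_response_le_quadratic`), while `c h² log(1/|h|) - C h²` exceeds `B h²` once
`log(1/|h|) > (C + B)/c`. [folklore] -/
theorem twSourcedCondensation_false_noCutoff :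
    ¬ (∀ μ₁ μ₂ : ℝ, -4 < μ₁ → μ₁ ≤ μ₂ → μ₂ < 0 → ∃ U₀ a c C h₀ : ℝ, 0 < U₀ ∧ 0 < a ∧ 0 < c ∧ 0 < C ∧
      0 < h₀ ∧ ∀ U : ℝ, 0 < U → U ≤ U₀ → ∀ β : ℝ, 1 ≤ β → β ≤ Real.exp (a / U) →
      ∀ μ ∈ Set.Icc μ₁ μ₂, ∃ L₀ : ℕ, ∀ (L : ℕ) [NeZero L], L₀ ≤ L → ∀ h : ℝ, |h| ≤ h₀ →
        c * h ^ 2 * Real.log (1 / |h|) - C * h ^ 2 ≤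
          Real.log (partitionFn β (dWaveSourceTorus L U μ h)).re / (β * (L : ℝ) ^ 2) -
            Real.log (partitionFn β (dWaveSourceTorus L U μ 0)).re / (β * (L : ℝ) ^ 2)) := by
  intro H
  obtain ⟨U₀, a, c, C, h₀, hU₀, ha, hc, hC, hh₀, H⟩ := H (-2) (-2) (by norm_num) le_rfl (by norm_num)
  obtain ⟨L₀, hL₀⟩ := H U₀ hU₀ le_rfl 1 le_rfl (Real.one_le_exp (div_nonneg ha.le hU₀.le)) (-2)
    ⟨le_rfl, le_rfl⟩
  set B : ℝ := 256 * 1 * ((L₀ + 1 : ℕ) : ℝ) ^ 2 with hB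
  have hBnn : 0 ≤ B := by positivity
  set h : ℝ := min h₀ (Real.exp (-((C + B) / c + 1))) with hh
  have hhpos : 0 < h := lt_min hh₀ (Real.exp_pos _)
  have key := hL₀ (L₀ + 1) (Nat.le_succ _) h (by rw [abs_of_pos hhpos]; exact min_le_left _ _)
  have hquad := pressure_response_le_quadratic (L₀ + 1) one_pos U₀ (-2) h
  rw [abs_of_pos hhpos, one_div, Real.log_inv] at key
  have hlogh : Real.log h ≤ -((C + B) / c + 1) := by
    rw [Real.log_le_iff_le_exp hhpos]; exact min_le_right _ _
  have h2 : C + B + c ≤ c * -Real.log h := by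
    have : (C + B) / c + 1 ≤ -Real.log h := by linarith
    have hcc : (C + B) / c * c = C + B := div_mul_cancel₀ _ hc.ne'
    nlinarith
  have h3 : 0 < h ^ 2 := by positivity
  have h4 : 0 < c * h ^ 2 := by positivity
  nlinarith [mul_le_mul_of_nonneg_left h2 h3.le]

/-! ### 5. The order `h²` is load-bearing: no first-order response at finite volume -/

/-- **FALSE: a first-order response** `c|h| ≤ p̃_L(h) - p̃_L(0)` (eventually in `L`, small `|h|`)
contradicts the quadratic bound at every fixed volume (`c|h| ≤ Bh²` fails for `0 < h < c/B`).
Every lower bound in this quantifier structure must be `O(h²)` as `h → 0`; the crux's is. [folklore] -/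
theorem twSourcedCondensation_false_linearResponse :
    ¬ (∀ μ₁ μ₂ : ℝ, -4 < μ₁ → μ₁ ≤ μ₂ → μ₂ < 0 → ∃ U₀ a c h₀ : ℝ, 0 < U₀ ∧ 0 < a ∧ 0 < c ∧ 0 < h₀ ∧
      ∀ U : ℝ, 0 < U → U ≤ U₀ → ∀ β : ℝ, 1 ≤ β → β ≤ Real.exp (a / U) →
      ∀ μ ∈ Set.Icc μ₁ μ₂, ∃ L₀ : ℕ, ∀ (L : ℕ) [NeZero L], L₀ ≤ L → ∀ h : ℝ, |h| ≤ h₀ →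
        c * |h| ≤
          Real.log (partitionFn β (dWaveSourceTorus L U μ h)).re / (β * (L : ℝ) ^ 2) -
            Real.log (partitionFn β (dWaveSourceTorus L U μ 0)).re / (β * (L : ℝ) ^ 2)) := by
  intro H
  obtain ⟨U₀, a, c, h₀, hU₀, ha, hc, hh₀, H⟩ := H (-2) (-2) (by norm_num) le_rfl (by norm_num)
  obtain ⟨L₀, hL₀⟩ := H U₀ hU₀ le_rfl 1 le_rfl (Real.one_le_exp (div_nonneg ha.le hU₀.le)) (-2)
    ⟨le_rfl, le_rfl⟩
  set B : ℝ := 256 * 1 * ((L₀ + 1 : ℕ) : ℝ) ^ 2 with hB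
  have hBnn : 0 ≤ B := by positivity
  set h : ℝ := min h₀ (c / (2 * (B + 1))) with hh
  have hhpos : 0 < h := lt_min hh₀ (by positivity)
  have key := hL₀ (L₀ + 1) (Nat.le_succ _) h (by rw [abs_of_pos hhpos]; exact min_le_left _ _)
  have hquad := pressure_response_le_quadratic (L₀ + 1) one_pos U₀ (-2) h
  rw [abs_of_pos hhpos] at key
  have hsmall : h * (2 * (B + 1)) ≤ c := by
    have := min_le_right h₀ (c / (2 * (B + 1)))
    rwa [← hh, le_div_iff₀ (by positivity)] at this
  nlinarith [mul_pos hc hhpos]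

end Summit.HubbardSuperconductivity.HubbardSuperconductivity.Theorems.TwSourcedCondensation.Negative
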